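import Summits.BirchSwinnertonDyer.Rank1Residual.X11b.RouteR1LogOmega
import Summits.BirchSwinnertonDyer.Rank1Residual.Partition.AnticyclotomicControlJSWEmbAt
import HarnessLib

/-!
# Route `SchneiderFreeAdditiveX3` (rung K1 door), crux r3 `GordTwoBranchIMC` (item 19177), layer 2 —
# the `𝔭 ↔ 𝔭̄` transport of `log_{ω_E} P`: THE embeddings at the two primes above a split `p`
# differ by the non-trivial automorphism of `K`, so `(log_{ω_E} P)²` is the same at both («K-τlog»)

Seat `bsd-schneider-door-c5` (prover, gen 7). Planner P2 g12's anatomy of Keller–Yin 2410.23241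
Thm. 3.5.1 (`memos/KY24b-anatomy-P2-g12.md` §2 F-slot, §6b) reads the printed main conjecture at the
embedding datum `conj ∘ ι'` — the one whose Selmer module is strict at OUR frame prime `𝔭` — and
feeds door-c3's rebased road (`additiveIMCLowerBDPOnTreeLeAt_of_valueAt_twisted_of_facts`, p464825)
the conjugate branch's series `L := 𝓛_{𝔭̄}`. The Castella–Hsieh value formula for that series reads
the Heegner point through the embedding of `K` AT `𝔭̄`, whereas the road's `h2` wants
`logOmega E p (embAt K p 𝔭 …) Q`. This file supplies the missing fact-free bookkeeping lemma
«K-τlog» of the memo, with `τ` never named by the consumer: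

* §1 **`exists_algEquiv_embAt_eq_comp`** — for `[K : ℚ] = 2` and two DISTINCT degree-one primes
  `𝔭 ≠ 𝔭'` of `𝓞 K` above `p`, THE embedding at `𝔭'` is THE embedding at `𝔭` precomposed with the
  non-trivial (involutive) `σ ∈ Gal(K/ℚ)`: `embAt K p 𝔭' = embAt K p 𝔭 ∘ σ`. Proof: `K/ℚ` is normal
  (quadratic), so every `ℚ`-embedding `K → ℚ_p` factors through the one at `𝔭` by an automorphism
  (Mathlib `Normal.algHomEquivAut`); that automorphism is not `1` because `embAt K p 𝔭` induces `𝔭`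
  and `embAt K p 𝔭'` induces `𝔭'` (tree `X11b.mem_asIdeal_iff_norm_embAt_lt_one`), and distinct
  maximal ideals are incomparable; `σ² = 1` because `#Gal(K/ℚ) ≤ [K:ℚ] = 2`.
* §2 **`logOmega_comp`** — functoriality: `logOmega W p (ι.comp τ) P = logOmega W p ι (τ_* P)` for
  any `τ : K →+* K'`, `ι : K' →+* ℚ_p` (Mathlib `Point.map_map`).
* §3 **`logOmega_embAt_eq_or_eq_neg_of_rank_one`** — for `W/ℚ` globally minimal elliptic,
  `[K:ℚ] = 2`, `rank_ℤ E(K) = 1`, ANY two degree-one primes `𝔭, 𝔭'` above `p` and any `P ∈ E(K)`: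
  `logOmega W p (embAt K p 𝔭') P = ± logOmega W p (embAt K p 𝔭) P` (the tree's
  `X11b.R1.logOmega_map_eq_or_eq_neg_of_rank_one`: `σ_* P = ±P + torsion` in rank one, `log` additive
  and zero on torsion; torsion `P` has `log = 0` on both sides, `X11b.R1.logOmega_eq_zero_iff`);
  hence **`sq_logOmega_embAt_eq_of_rank_one`** (`(log_{𝔭'} P)² = (log_𝔭 P)²`) and the value-shape
  corollary **`hasValueAt_sq_logOmega_embAt_iff_of_rank_one`** (`L(𝟙) = u·(log P / c)²` holds with
  the logarithm at `𝔭'` iff with the logarithm at `𝔭`) — exactly the rewrite that turns the CH18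
  value of `𝓛_{𝔭̄}` into door-c3's `h2` at `𝔭`.

Nothing here is specific to Heegner points or to the door's cells; no named fact is used; BSD is not
advanced (helper for the KY-fed reading of crux r3's layer 2; `--supports stmt-BirchSwinnertonDyer-19177`).

References: Keller–Yin arXiv:2410.23241 Def. 3.4.1 / Thm. 3.5.1 (the `(v, v̄)` slotting);
Castella–Grossi–Lee–Skinner, Invent. Math. (2022) §2 («`v` the prime of `K` above `p` induced by
`ι_p`»); [Castella2018] §2.2, Thm. 2.3 (arXiv:1704.06608 p. 5: `P ∈ E(K) ⊂ E(K_𝔭)`, `log_{ω_E}`);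
[SilvermanAEC2009] IV.6.4, VIII.6.7; [FrohlichTaylor1990] III §1 (1.14)(a).
-/

set_option autoImplicit false
set_option linter.dupNamespace false

noncomputable section

open scoped Classical

namespace Summit.BirchSwinnertonDyer.BirchSwinnertonDyer.Theorems.SchneiderFreeAdditiveX3

open WeierstrassCurve NumberField IsDedekindDomain Field
open Literature.NumberTheory.EllipticCurves
open Summit.BirchSwinnertonDyer.Rank1Residual
open Summit.BirchSwinnertonDyer.Rank1Residual.X11b
open Summit.BirchSwinnertonDyer.Rank1Residual.X11b.Halves

/-! ### §1 THE embeddings at the two primes above a split `p` differ by the non-trivial automorphism -/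

section Embeddings

variable {K : Type} [Field K] [NumberField K] {p : ℕ} [Fact p.Prime]

/-- An automorphism of a quadratic field is an involution: `#Gal(K/ℚ) ≤ [K:ℚ] = 2`
(Mathlib `AlgEquiv.card_le`), so `σ² = 1`. [folklore] -/
theorem algEquiv_mul_self_eq_one_of_finrank_eq_two (h2 : Module.finrank ℚ K = 2) (σ : K ≃ₐ[ℚ] K) :
    σ * σ = 1 := by
  have hcard : Fintype.card (K ≃ₐ[ℚ] K) ≤ 2 := h2 ▸ AlgEquiv.card_le
  have hpos : 0 < Fintype.card (K ≃ₐ[ℚ] K) := Fintype.card_pos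
  have hpow : σ ^ Fintype.card (K ≃ₐ[ℚ] K) = 1 := pow_card_eq_one
  interval_cases h : Fintype.card (K ≃ₐ[ℚ] K)
  · rw [pow_one] at hpow
    rw [hpow, one_mul]
  · rw [← pow_two]
    exact hpow

/-- **THE embedding at `𝔭'` is THE embedding at `𝔭` precomposed with the non-trivial automorphism of
`K`**: for `[K:ℚ] = 2` and distinct degree-one primes `𝔭 ≠ 𝔭'` of `𝓞 K` above `p` there is
`σ ∈ Gal(K/ℚ)`, `σ ≠ 1`, `σ² = 1`, with `embAt K p 𝔭' x = embAt K p 𝔭 (σ x)` for every `x ∈ K`.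
`K/ℚ` is normal, so the `ℚ`-embedding `embAt K p 𝔭'` factors through `embAt K p 𝔭` by an
automorphism (`Normal.algHomEquivAut`); it is not the identity since the two embeddings induce the
distinct primes `𝔭'`, `𝔭` (`X11b.mem_asIdeal_iff_norm_embAt_lt_one`) and distinct maximal ideals
are incomparable. [cite: CastellaGrossiLeeSkinner2022, §2 (arXiv v2 TeX L479: «`v` the prime of `K` above `p` induced by `ι_p`»; `v̄` is induced by `ι_p ∘ c`)]
[cite: FrohlichTaylor1990, Ch. III §1 (1.14)(a)] -/
theorem exists_algEquiv_embAt_eq_comp (h2 : Module.finrank ℚ K = 2)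
    {𝔭 𝔭' : HeightOneSpectrum (𝓞 K)} (h𝔭 : ((p : ℕ) : 𝓞 K) ∈ 𝔭.asIdeal)
    (he : 𝔭.asIdeal.ramificationIdx (𝓞 ℚ) = 1) (hf : 𝔭.asIdeal.inertiaDeg (𝓞 ℚ) = 1)
    (h𝔭' : ((p : ℕ) : 𝓞 K) ∈ 𝔭'.asIdeal)
    (he' : 𝔭'.asIdeal.ramificationIdx (𝓞 ℚ) = 1) (hf' : 𝔭'.asIdeal.inertiaDeg (𝓞 ℚ) = 1)
    (hne : 𝔭' ≠ 𝔭) :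
    ∃ σ : K ≃ₐ[ℚ] K, σ ≠ 1 ∧ (∀ x, σ (σ x) = x) ∧
      ∀ x, embAt K p 𝔭' h𝔭' he' hf' x = embAt K p 𝔭 h𝔭 he hf (σ x) := by
  letI : Algebra K ℚ_[p] := (embAt K p 𝔭 h𝔭 he hf).toAlgebra
  haveI : Algebra.IsQuadraticExtension ℚ K := { finrank_eq_two' := h2 }
  set ψ : K →ₐ[ℚ] ℚ_[p] := (embAt K p 𝔭' h𝔭' he' hf').toRatAlgHom with hψ_def
  set σ : K ≃ₐ[ℚ] K := Normal.algHomEquivAut ℚ ℚ_[p] K ψ with hσ_def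
  have hψ : ψ = (IsScalarTower.toAlgHom ℚ K ℚ_[p]).comp σ.toAlgHom :=
    ((Normal.algHomEquivAut ℚ ℚ_[p] K).symm_apply_apply ψ).symm
  have happ : ∀ x, embAt K p 𝔭' h𝔭' he' hf' x = embAt K p 𝔭 h𝔭 he hf (σ x) := by
    intro x
    have hx := AlgHom.congr_fun hψ x
    rw [hψ_def, RingHom.toRatAlgHom_apply] at hx
    rw [hx]
    rfl
  refine ⟨σ, ?_, fun x ↦ ?_, happ⟩
  · intro h1
    -- then the two embeddings coincide, yet they induce the distinct primes `𝔭'` and `𝔭`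
    have heq : ∀ x, embAt K p 𝔭' h𝔭' he' hf' x = embAt K p 𝔭 h𝔭 he hf x := by
      intro x; rw [happ x, h1, AlgEquiv.one_apply]
    have hle : 𝔭.asIdeal ≤ 𝔭'.asIdeal := by
      intro x hx
      rw [mem_asIdeal_iff_norm_embAt_lt_one 𝔭' h𝔭' he' hf' x, heq]
      exact (mem_asIdeal_iff_norm_embAt_lt_one 𝔭 h𝔭 he hf x).mp hx
    exact hne (HeightOneSpectrum.ext
      ((HeightOneSpectrum.isMaximal 𝔭).eq_of_le (HeightOneSpectrum.isMaximal 𝔭').ne_top hle).symm)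
  · have h := algEquiv_mul_self_eq_one_of_finrank_eq_two h2 σ
    have hx := AlgEquiv.congr_fun h x
    rwa [AlgEquiv.mul_apply, AlgEquiv.one_apply] at hx

end Embeddings

/-! ### §2 Functoriality of `log_{ω_E}` in the embedding -/

section Functoriality

variable (W : WeierstrassCurve ℚ) [W.IsElliptic] [W.IsGloballyMinimal] (p : ℕ) [Fact p.Prime]
  {K K' : Type} [Field K] [NumberField K] [Field K'] [NumberField K']

omit [W.IsElliptic] [W.IsGloballyMinimal] in
/-- `P` read along `ι ∘ τ` is `τ_* P` read along `ι` (Mathlib `Point.map_map`). [folklore] -/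
theorem padicPointOf_comp (ι : K' →+* ℚ_[p]) (τ : K →+* K') (P : (W.baseChange K).toAffine.Point) :
    X11b.padicPointOf W p (ι.comp τ) P =
      X11b.padicPointOf W p ι (WeierstrassCurve.Affine.Point.map τ.toRatAlgHom P) := by
  unfold X11b.padicPointOf
  rw [WeierstrassCurve.Affine.Point.map_map]
  rcases P with _ | ⟨x, y, hxy⟩
  · rfl
  · rfl

/-- **`logOmega W p (ι ∘ τ) P = logOmega W p ι (τ_* P)`**: the receptacle's logarithm only sees the
image point in `E(ℚ_p)`. [cite: Castella2018, §2.2 (arXiv:1704.06608 p. 5), `P ∈ E(K) ⊂ E(K_𝔭)`] -/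
theorem logOmega_comp (ι : K' →+* ℚ_[p]) (τ : K →+* K') (P : (W.baseChange K).toAffine.Point) :
    logOmega W p (ι.comp τ) P = logOmega W p ι (WeierstrassCurve.Affine.Point.map τ.toRatAlgHom P) := by
  unfold logOmega
  rw [padicPointOf_comp]

end Functoriality

/-! ### §3 `(log_{ω_E} P)²` is the same at both primes above a split `p` (rank one) -/

section RankOne

variable (W : WeierstrassCurve ℚ) [W.IsElliptic] [W.IsGloballyMinimal] (p : ℕ) [Fact p.Prime]
  {K : Type} [Field K] [NumberField K]

/-- **K-τlog.** For `[K:ℚ] = 2`, `rank_ℤ E(K) = 1`, any two degree-one primes `𝔭, 𝔭'` of `𝓞 K`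
above `p` and any `P ∈ E(K)`: `log_{ω_E} P` read at `𝔭'` is `±` `log_{ω_E} P` read at `𝔭`
(`embAt K p 𝔭' = embAt K p 𝔭 ∘ σ`, §1; `σ_* P = ±P + T` with `T` torsion in rank one, and `log`
is additive and kills torsion — the tree's `X11b.R1.logOmega_map_eq_or_eq_neg_of_rank_one`; a
torsion `P` has `log = 0` at both primes). No parity or reduction hypothesis on `p`.
[cite: SilvermanAEC2009, VIII.6.7 and IV.6.4] [cite: Castella2018, Thm. 2.3 (arXiv:1704.06608 p. 5)] -/
theorem logOmega_embAt_eq_or_eq_neg_of_rank_one (h2 : Module.finrank ℚ K = 2)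
    (hrk : (W.baseChange K).mordellWeilRank = 1)
    {𝔭 𝔭' : HeightOneSpectrum (𝓞 K)} (h𝔭 : ((p : ℕ) : 𝓞 K) ∈ 𝔭.asIdeal)
    (he : 𝔭.asIdeal.ramificationIdx (𝓞 ℚ) = 1) (hf : 𝔭.asIdeal.inertiaDeg (𝓞 ℚ) = 1)
    (h𝔭' : ((p : ℕ) : 𝓞 K) ∈ 𝔭'.asIdeal)
    (he' : 𝔭'.asIdeal.ramificationIdx (𝓞 ℚ) = 1) (hf' : 𝔭'.asIdeal.inertiaDeg (𝓞 ℚ) = 1)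
    (P : (W.baseChange K).toAffine.Point) :
    logOmega W p (embAt K p 𝔭' h𝔭' he' hf') P = logOmega W p (embAt K p 𝔭 h𝔭 he hf) P ∨
      logOmega W p (embAt K p 𝔭' h𝔭' he' hf') P = -logOmega W p (embAt K p 𝔭 h𝔭 he hf) P := by
  by_cases hP : IsOfFinAddOrder P
  · left
    rw [(R1.logOmega_eq_zero_iff W p _ P).mpr hP, (R1.logOmega_eq_zero_iff W p _ P).mpr hP]
  by_cases hne : 𝔭' = 𝔭
  · left
    subst hne
    rfl
  obtain ⟨σ, -, hσσ, happ⟩ := exists_algEquiv_embAt_eq_comp h2 h𝔭 he hf h𝔭' he' hf' hne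
  have hcomp : embAt K p 𝔭' h𝔭' he' hf' = (embAt K p 𝔭 h𝔭 he hf).comp (σ : K →+* K) :=
    RingHom.ext fun x ↦ by rw [RingHom.comp_apply, happ]; rfl
  rw [hcomp, logOmega_comp]
  exact R1.logOmega_map_eq_or_eq_neg_of_rank_one W p (embAt K p 𝔭 h𝔭 he hf) (σ : K →+* K)
    (fun x ↦ hσσ x) hrk hP

/-- **`(log_{ω_E} P)²` at `𝔭'` equals `(log_{ω_E} P)²` at `𝔭`** ([K:ℚ] = 2, rank one, any two
degree-one primes above `p`, any `P`). [cite: SilvermanAEC2009, VIII.6.7 and IV.6.4] -/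
theorem sq_logOmega_embAt_eq_of_rank_one (h2 : Module.finrank ℚ K = 2)
    (hrk : (W.baseChange K).mordellWeilRank = 1)
    {𝔭 𝔭' : HeightOneSpectrum (𝓞 K)} (h𝔭 : ((p : ℕ) : 𝓞 K) ∈ 𝔭.asIdeal)
    (he : 𝔭.asIdeal.ramificationIdx (𝓞 ℚ) = 1) (hf : 𝔭.asIdeal.inertiaDeg (𝓞 ℚ) = 1)
    (h𝔭' : ((p : ℕ) : 𝓞 K) ∈ 𝔭'.asIdeal)
    (he' : 𝔭'.asIdeal.ramificationIdx (𝓞 ℚ) = 1) (hf' : 𝔭'.asIdeal.inertiaDeg (𝓞 ℚ) = 1)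
    (P : (W.baseChange K).toAffine.Point) :
    logOmega W p (embAt K p 𝔭' h𝔭' he' hf') P ^ 2 = logOmega W p (embAt K p 𝔭 h𝔭 he hf) P ^ 2 := by
  rcases logOmega_embAt_eq_or_eq_neg_of_rank_one W p h2 hrk h𝔭 he hf h𝔭' he' hf' P with h | h <;>
    rw [h]
  ring

/-- **The BDP value shape does not see which prime above `p` carries the logarithm**: for any unit
factor `u ∈ ℂ_p`, constant `c ∈ ℚ_p` (the parametrisation constant) and series `L`,
`L(𝟙) = u·(log_{𝔭'} P / c)²` iff `L(𝟙) = u·(log_𝔭 P / c)²` ([K:ℚ] = 2, rank one) — the rewrite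
that turns the Castella–Hsieh value of the conjugate branch `𝓛_{𝔭̄}` into door-c3's `h2` at `𝔭`
(P2 g12 anatomy §6b). [cite: Castella2018, Thm. 3.2 and §5 (arXiv:1704.06608 pp. 9, 12) (shape only; nothing asserted)] -/
theorem hasValueAt_sq_logOmega_embAt_iff_of_rank_one (h2 : Module.finrank ℚ K = 2)
    (hrk : (W.baseChange K).mordellWeilRank = 1)
    {𝔭 𝔭' : HeightOneSpectrum (𝓞 K)} (h𝔭 : ((p : ℕ) : 𝓞 K) ∈ 𝔭.asIdeal)
    (he : 𝔭.asIdeal.ramificationIdx (𝓞 ℚ) = 1) (hf : 𝔭.asIdeal.inertiaDeg (𝓞 ℚ) = 1)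
    (h𝔭' : ((p : ℕ) : 𝓞 K) ∈ 𝔭'.asIdeal)
    (he' : 𝔭'.asIdeal.ramificationIdx (𝓞 ℚ) = 1) (hf' : 𝔭'.asIdeal.inertiaDeg (𝓞 ℚ) = 1)
    (P : (W.baseChange K).toAffine.Point) (u : ℂ_[p]) (c : ℚ_[p]) (L : UnrSeries p) :
    L.HasValueAt 0 (u * (algebraMap ℚ_[p] ℂ_[p]
        (logOmega W p (embAt K p 𝔭' h𝔭' he' hf') P / c)) ^ 2) ↔
      L.HasValueAt 0 (u * (algebraMap ℚ_[p] ℂ_[p]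
        (logOmega W p (embAt K p 𝔭 h𝔭 he hf) P / c)) ^ 2) := by
  have h := sq_logOmega_embAt_eq_of_rank_one W p h2 hrk h𝔭 he hf h𝔭' he' hf' P
  rw [← map_pow, ← map_pow, div_pow, div_pow, h]

end RankOne

end Summit.BirchSwinnertonDyer.BirchSwinnertonDyer.Theorems.SchneiderFreeAdditiveX3

end
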